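import Summits.ResolutionOfSingularities.ResolutionOfSingularities.Theorems.MarkedTransferCampaignW21AlongCentreSeries
import Summits.ResolutionOfSingularities.ResolutionOfSingularities.Theorems.MarkedTransferCampaignW21MinedHypothesis
import HarnessLib

/-!
# [OURS · L1 W2.1] The centre witness DATUM: the depth-3 standard expression (`e = 1`) of
# `ε = y^{p−1} ω₁^{p+1} ω₂^{p} + y^{p−1} ω₁ ω₂^{2p} + ω₁^{p} ω₂^{p²+p} ∈ 𝔽_p⟦y, ω₁, ω₂⟧`, a `MinDegreeTop` datum in Case (I) ONLY
# whose diff-product is `H♭(ε) = ε + ω₂^{p²+2p}` (every prime `p`)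

Rung L (rescue) of cell res-hironaka, RESCUE-SEED row L-G2, slot W2.1, seat res-L1-s21-pv-1 (USE half of the slot; see
the companion `MarkedTransferCampaignW21AlongCentreSeries.lean` for the series-level computations and the framing).

THIS FILE builds, for EVERY prime `p`, the row-052 datum of `ε` with triples
`{((p−1,1,0); 0; (0,1,1)), ((p−1,1,0); 0; (0,0,2)), (0; 0; (0,1,p+1))}` (`e = 1`, `q = p`, depth `ℓ = 3`, all
coefficients `1`), computes its row-054 top frontier (`α = (p−1,1,0)`, `β = 0`, top block
`{γ₀ = (0,1,1) >lex γ₁ = (0,0,2)}`, `m + 1 = 2`), checks `Standing` (`u₀ = 1`, `α ≠ 0`, `ord ε = 3p > p = q`,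
`|α+pβ+qγ₀| = 3p < p³`), Case (I) (`|qγ₀| = 2p ≥ 2q`), NOT Case (II) (`|α+pβ| = p ≤ q`), NOT Case (III) (`|qγ₀| = 2p ≠ q`),
membership in `MinDegreeTop` (`|α+pβ+qγ₀| = 3p = ord ε`; the class `P` of GAP row R05's FOLLOWS-MODULO-P reading, whose
bound AT `ξ` is res-L1-k21's theorem `orderBoundMinDegreeTop_holds`, p463892) — hence in `TopDegreeLeOrder`,
`ShortTopGamma`, `LucasClass` — and identifies the Case-(I) value `H♭(ε) = u₀⁻¹ ∂^{(α+pβ)}ε · ∂^{(qγ₀)}ε = ε + ω₂^{p²+2p}`,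
of order `3p = ord ε` AT `ξ`. The consequences ALONG the smooth centre `D = V(y, ω₁)` are drawn in
`MarkedTransferCampaignW21AlongCentreRefutation.lean`. Everything here is OURS / folklore about an OURS datum; nothing is
a statement of or about the manuscript under adjudication; AI-produced formalisation, expert review is stronger than AI
review.
-/

noncomputable section

set_option linter.dupNamespace false -- mandated namespace of this single-conjunct summit

namespace Summit.ResolutionOfSingularities.ResolutionOfSingularities.Theorems

namespace CampaignW21

open Literature.AlgebraicGeometry.Hironaka2017.S08UnitMonomial
open Literature.AlgebraicGeometry.Hironaka2017.S09LLUED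
open Literature.AlgebraicGeometry.Hironaka2017.S09LLUED.TopFrontier
open Literature.AlgebraicGeometry.Resolution
open Literature.RingTheory.MvPowerSeries
open MvPowerSeries Finsupp

namespace AlongCentreWitness

variable (p : ℕ) [hp : Fact p.Prime]

/-! ### The standard-expression datum (`e = 1`) and its top frontier -/

/-- The three index triples `(a; b; c)`. [folklore] -/
def t₁ : ExpTriple 3 := (e3 (p - 1) 1 0, 0, e3 0 1 1)
/-- [folklore] -/
def t₂ : ExpTriple 3 := (e3 (p - 1) 1 0, 0, e3 0 0 2)
/-- [folklore] -/
def t₃ : ExpTriple 3 := (0, 0, e3 0 1 (p + 1))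
/-- The support. [folklore] -/
def T : Finset (ExpTriple 3) := {t₁ p, t₂ p, t₃ p}
/-- All coefficients are `1`. [folklore] -/
def uu : ExpTriple 3 → R p := fun _ => 1

omit hp in
/-- [folklore] -/
theorem t₁_ne_t₂ : t₁ p ≠ t₂ p := fun h => by
  simpa [t₁, t₂, e3_apply_one] using congrArg (fun t : ExpTriple 3 => t.2.2 1) h
omit hp in
/-- [folklore] -/
theorem t₁_ne_t₃ : t₁ p ≠ t₃ p := fun h => by
  simpa [t₁, t₃, e3_apply_one] using congrArg (fun t : ExpTriple 3 => t.1 1) h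
omit hp in
/-- [folklore] -/
theorem t₂_ne_t₃ : t₂ p ≠ t₃ p := fun h => by
  simpa [t₂, t₃, e3_apply_one] using congrArg (fun t : ExpTriple 3 => t.1 1) h

omit hp in
/-- [folklore] -/
theorem mem_T {t : ExpTriple 3} : t ∈ T p ↔ t = t₁ p ∨ t = t₂ p ∨ t = t₃ p := by
  simp [T]

/-- [folklore] -/
theorem effSupport_T : effSupport (T p) (uu p) = T p := by
  ext t; simp [effSupport, uu]

/-- The lexicographic key of the top pair `((p−1,1,0), 0)`. [folklore] -/
def K₁ : Lex (Lex (Fin 3 →₀ ℕ) × Lex (Fin 3 →₀ ℕ)) := toLex (toLex (e3 (p - 1) 1 0), toLex 0)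

omit hp in
/-- [folklore] -/
theorem pairKey_le (t : ExpTriple 3) (ht : t ∈ T p) : pairKey t ≤ K₁ p := by
  rcases (mem_T p).1 ht with rfl | rfl | rfl
  · exact le_rfl
  · exact le_rfl
  · exact Prod.Lex.toLex_mono
      ⟨Finsupp.toLex_monotone (show (0 : Fin 3 →₀ ℕ) ≤ e3 (p - 1) 1 0 from fun i => Nat.zero_le _), le_rfl⟩

/-- [folklore] -/
theorem topPair_T : topPair (T p) (uu p) = (e3 (p - 1) 1 0, 0) := by
  have h1 : t₁ p ∈ effSupport (T p) (uu p) := by rw [effSupport_T]; exact (mem_T p).2 (Or.inl rfl)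
  have hmax : ∀ h, ((effSupport (T p) (uu p)).image pairKey).max' h = K₁ p := fun h =>
    le_antisymm (Finset.max'_le _ _ _ fun k hk => by
        obtain ⟨t, ht, rfl⟩ := Finset.mem_image.1 hk
        exact pairKey_le p t (by rwa [effSupport_T] at ht))
      (Finset.le_max' _ (K₁ p) ((Finset.mem_image (f := pairKey)).2 ⟨t₁ p, h1, rfl⟩))
  unfold topPair
  rw [dif_pos ⟨t₁ p, h1⟩]
  simp only [hmax]
  rfl

/-- `α = (p−1, 1, 0)`. [folklore] -/
theorem alpha_T : alpha (T p) (uu p) = e3 (p - 1) 1 0 := by rw [alpha, topPair_T]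
/-- `β = 0`. [folklore] -/
theorem beta_T : beta (T p) (uu p) = 0 := by rw [beta, topPair_T]

/-- The top block `{y^{p−1}ω₁^{p+1}ω₂^p, y^{p−1}ω₁ω₂^{2p}}`. [folklore] -/
theorem topBlock_T : topBlock (T p) (uu p) = {t₁ p, t₂ p} := by
  unfold topBlock
  rw [effSupport_T, alpha_T, beta_T]
  ext t
  simp only [Finset.mem_filter, mem_T, Finset.mem_insert, Finset.mem_singleton]
  constructor
  · rintro ⟨h | h | h, h1, -⟩
    · exact Or.inl h
    · exact Or.inr h
    · exfalso; subst h
      have h' := DFunLike.congr_fun h1 1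
      simp [t₃, e3_apply_one] at h'
  · rintro (rfl | rfl)
    · exact ⟨Or.inl rfl, rfl, rfl⟩
    · exact ⟨Or.inr (Or.inl rfl), rfl, rfl⟩

/-- [folklore] -/
theorem mem_gammaKeys_T {k : Lex (Fin 3 →₀ ℕ)} :
    k ∈ gammaKeys (T p) (uu p) ↔ k = toLex (e3 0 1 1) ∨ k = toLex (e3 0 0 2) := by
  unfold gammaKeys
  rw [topBlock_T, Finset.mem_image]
  constructor
  · rintro ⟨t, ht, rfl⟩
    simp only [Finset.mem_insert, Finset.mem_singleton] at ht
    rcases ht with rfl | rfl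
    · exact Or.inl rfl
    · exact Or.inr rfl
  · rintro (rfl | rfl)
    · exact ⟨t₁ p, by simp, rfl⟩
    · exact ⟨t₂ p, by simp, rfl⟩

omit hp in
/-- `(0,0,2) <lex (0,1,1)`. [folklore] -/
theorem toLex_e3_002_lt : (toLex (e3 0 0 2) : Lex (Fin 3 →₀ ℕ)) < toLex (e3 0 1 1) := by
  rw [Finsupp.Lex.lt_iff]
  refine ⟨1, fun j hj => ?_, ?_⟩
  · have : j = 0 := by
      apply Fin.ext
      have := Fin.lt_def.1 hj
      simp at this
      omega
    subst this
    show (e3 0 0 2) 0 = (e3 0 1 1) 0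
    rw [e3_apply_zero, e3_apply_zero]
  · show (e3 0 0 2) 1 < (e3 0 1 1) 1
    rw [e3_apply_one, e3_apply_one]; exact Nat.zero_lt_one

omit hp in
/-- [folklore] -/
theorem toLex_e3_ne : (toLex (e3 0 1 1) : Lex (Fin 3 →₀ ℕ)) ≠ toLex (e3 0 0 2) :=
  (ne_of_lt toLex_e3_002_lt).symm

/-- `m + 1 = 2`. [folklore] -/
theorem frontierLength_T : frontierLength (T p) (uu p) = 2 := by
  have : gammaKeys (T p) (uu p) = {toLex (e3 0 1 1), toLex (e3 0 0 2)} := by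
    ext k; rw [mem_gammaKeys_T]; simp
  rw [frontierLength, this]
  exact Finset.card_pair toLex_e3_ne

/-- [folklore] -/
theorem frontierLength_T_pos : 0 < frontierLength (T p) (uu p) := by
  rw [frontierLength_T]; exact Nat.succ_pos 1

/-- `γ₀ = (0,1,1)` (the lexicographically largest top-block exponent). [folklore] -/
theorem gamma_zero_T (h0 : 0 < frontierLength (T p) (uu p)) : gamma (T p) (uu p) ⟨0, h0⟩ = e3 0 1 1 := by
  have hmax : ∀ h, (gammaKeys (T p) (uu p)).max' h = toLex (e3 0 1 1) := fun h =>
    le_antisymm (Finset.max'_le _ _ _ fun k hk => by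
        rcases (mem_gammaKeys_T p).1 hk with rfl | rfl
        · exact le_rfl
        · exact le_of_lt toLex_e3_002_lt)
      (Finset.le_max' _ _ ((mem_gammaKeys_T p).2 (Or.inl rfl)))
  have key : ∀ (k : ℕ) (hk : (gammaKeys (T p) (uu p)).card = k) (i : Fin k), i.val = k - 1 →
      ofLex ((gammaKeys (T p) (uu p)).orderEmbOfFin hk i) = e3 0 1 1 := by
    rintro k hk ⟨i, hi⟩ (h : i = k - 1)
    subst h
    rw [Finset.orderEmbOfFin_last hk (by omega), hmax]
    rfl
  exact key _ rfl _ (by simp [Fin.val_rev])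

/-- Every top-block exponent has length `2` (`|γ₀| = |(0,1,1)| = 2`, `|γ₁| = |(0,0,2)| = 2`). [folklore] -/
theorem gamma_degree_T (j : Fin (frontierLength (T p) (uu p))) : (gamma (T p) (uu p) j).degree = 2 := by
  have hm := Finset.orderEmbOfFin_mem (gammaKeys (T p) (uu p)) rfl (Fin.rev j)
  rw [mem_gammaKeys_T] at hm
  change (ofLex ((gammaKeys (T p) (uu p)).orderEmbOfFin rfl (Fin.rev j))).degree = 2
  rcases hm with hm | hm
  · rw [hm]; show (e3 0 1 1).degree = 2; rw [e3_degree]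
  · rw [hm]; show (e3 0 0 2).degree = 2; rw [e3_degree]

/-- **The depth-3 standard expression of `ε` with `e = 1`** (`q = p`; `a_i < p`, `b = 0 < p⁰`, coefficients `1 ∈ ρ³`).
[folklore] -/
def stdExpr : StandardExpression p (xs (ZMod p) 3) 1 3 (eps p) where
  support := T p
  u := uu p
  u_mem := fun _ _ => ⟨1, one_pow _⟩
  u_unit_or_zero := fun _ _ => Or.inl isUnit_one
  a_lt := by
    intro t ht i
    have h1 : 1 < p := hp.out.one_lt
    rcases (mem_T p).1 ht with rfl | rfl | rfl <;> fin_cases i <;>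
      simp [t₁, t₂, t₃, e3_apply_zero, e3_apply_one, e3_apply_two] <;> omega
  b_lt := by
    intro t ht j
    rcases (mem_T p).1 ht with rfl | rfl | rfl <;> fin_cases j <;> simp [t₁, t₂, t₃]
  sum_eq := by
    rw [T, Finset.sum_insert (by simp [t₁_ne_t₂, t₁_ne_t₃]), Finset.sum_insert (by simp [t₂_ne_t₃]),
      Finset.sum_singleton]
    simp only [Fin.prod_univ_three, t₁, t₂, t₃, xs, uu, e3_apply_zero, e3_apply_one, e3_apply_two, Finsupp.coe_zero,
      Pi.zero_apply, mul_zero, pow_zero, one_mul, mul_one, pow_one]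
    simp only [eps]
    ring

/-- The `Standing` binders hold (`u₀ = 1`, `α ≠ 0`, `ord ε = 3p > p`, `|α+pβ+qγ₀| = 3p < p³`). [folklore] -/
theorem standing : Standing p 1 3 (eps p) (stdExpr p) (frontierLength_T_pos p) where
  unit_u0 := isUnit_one
  alpha_ne := by
    intro h
    have h' := DFunLike.congr_fun (show alpha (T p) (uu p) = 0 from h) 1
    rw [alpha_T, e3_apply_one] at h'
    exact one_ne_zero h'
  ord_lt := by
    show ((p ^ 1 : ℕ) : ℕ∞) < adicOrder (eps p)
    rw [pow_one, adicOrder_eps]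
    have h1 : 1 < p := hp.out.one_lt
    exact_mod_cast (show p < 3 * p by omega)
  depth := by
    show (alpha (T p) (uu p) + p • beta (T p) (uu p) + p ^ 1 • gamma (T p) (uu p) ⟨0, frontierLength_T_pos p⟩).degree
      < p ^ 3
    rw [alpha_T, beta_T, gamma_zero_T, smul_zero, add_zero, pow_one, smul_e3, e3_add, e3_degree]
    have h2 : 2 ≤ p := hp.out.two_le
    have : 2 * 2 * p ≤ p ^ 3 := by
      rw [pow_succ, pow_two]
      exact Nat.mul_le_mul_right _ (Nat.mul_le_mul h2 h2)
    omega

/-- `|α + pβ + qγ₀| = 3p`. [folklore] -/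
theorem topDegree_T :
    (alpha (T p) (uu p) + p • beta (T p) (uu p) + p ^ 1 • gamma (T p) (uu p) ⟨0, frontierLength_T_pos p⟩).degree =
      3 * p := by
  rw [alpha_T, beta_T, gamma_zero_T, smul_zero, add_zero, pow_one, smul_e3, e3_add, e3_degree]
  have h1 : 1 < p := hp.out.one_lt
  omega

/-- Case (I) of Lem. 9.6 holds: `|qγ₀| = 2p ≥ 2q`. [folklore] -/
theorem isCaseI : IsCaseI (p ^ 1) (gamma (T p) (uu p) ⟨0, frontierLength_T_pos p⟩) := by
  show 2 * p ^ 1 ≤ (p ^ 1 • gamma (T p) (uu p) ⟨0, frontierLength_T_pos p⟩).degree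
  rw [gamma_zero_T, pow_one, smul_e3, e3_degree]
  omega

/-- Case (II) of Lem. 9.6 does NOT hold: `|α + pβ| = p ≤ q`. [folklore] -/
theorem not_isCaseII : ¬ IsCaseII p (p ^ 1) (alpha (T p) (uu p)) (beta (T p) (uu p)) := by
  show ¬ p ^ 1 < (alpha (T p) (uu p) + p • beta (T p) (uu p)).degree
  rw [alpha_T, beta_T, smul_zero, add_zero, e3_degree, pow_one]
  have h1 : 1 < p := hp.out.one_lt
  omega

/-- `|α + pβ| = p ≤ q` (the datum is «Case (I) only»). [folklore] -/
theorem topFrontier_degree_le : (alpha (T p) (uu p) + p • beta (T p) (uu p)).degree ≤ p ^ 1 := by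
  rw [alpha_T, beta_T, smul_zero, add_zero, e3_degree, pow_one]
  have h1 : 1 < p := hp.out.one_lt
  omega

/-- Case (III) of Lem. 9.6 does NOT hold: `|qγ₀| = 2p ≠ q`. [folklore] -/
theorem not_isCaseIII :
    ¬ IsCaseIII p (p ^ 1) (alpha (T p) (uu p)) (beta (T p) (uu p)) (gamma (T p) (uu p) ⟨0, frontierLength_T_pos p⟩) := by
  rintro ⟨-, -, h, -⟩
  rw [gamma_zero_T, pow_one, smul_e3, e3_degree] at h
  have h1 : 1 < p := hp.out.one_lt
  omega

/-- **The witness lies in `MinDegreeTop`** (the class `P` of GAP row R05's FOLLOWS-MODULO-P reading, whose order bound AT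
`ξ` is the theorem `orderBoundMinDegreeTop_holds`, p463892): `|α+pβ+qγ₀| = 3p = ord ε`. [folklore] -/
theorem minDegreeTop : MinDegreeTop p 1 (eps p) (stdExpr p) := by
  intro h0
  show adicOrder (eps p) = ((alpha (T p) (uu p) + p • beta (T p) (uu p) + p ^ 1 • gamma (T p) (uu p) ⟨0, h0⟩).degree : ℕ∞)
  rw [topDegree_T, adicOrder_eps]

/-- The witness lies in class (D) `TopDegreeLeOrder`. [folklore] -/
theorem topDegreeLeOrder : TopDegreeLeOrder p 1 (eps p) (stdExpr p) := by
  intro h0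
  show ((alpha (T p) (uu p) + p • beta (T p) (uu p) + p ^ 1 • gamma (T p) (uu p) ⟨0, h0⟩).degree : ℕ∞) ≤
    adicOrder (eps p)
  rw [topDegree_T, adicOrder_eps]

/-- The witness lies in `ShortTopGamma` (`q|γ₀| = 2p ≤ 3p = ord ε`, `|γ₀| = 2 = |γ_j|`). [folklore] -/
theorem shortTopGamma : ShortTopGamma p 1 (eps p) (stdExpr p) := by
  intro h0
  refine ⟨?_, fun j => ?_⟩
  · show ((p ^ 1 * (gamma (T p) (uu p) ⟨0, h0⟩).degree : ℕ) : ℕ∞) ≤ adicOrder (eps p)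
    rw [gamma_zero_T, e3_degree, adicOrder_eps, pow_one]
    exact_mod_cast (show p * (0 + 1 + 1) ≤ 3 * p by omega)
  · show (gamma (T p) (uu p) ⟨0, h0⟩).degree ≤ (gamma (T p) (uu p) j).degree
    rw [gamma_degree_T, gamma_degree_T]

/-- The witness lies in the Lucas class. [folklore] -/
theorem lucasClass : LucasClass p 1 (eps p) (stdExpr p) := Or.inr (shortTopGamma p)

/-- The Case-(I) value `H♭(ε) = ∂^{(p−1,1,0)}ε · ∂^{(0,p,p)}ε` (the leading unit is `1`). [folklore] -/
theorem caseI_eq (u : (R p)ˣ) (hu : (u : R p) = 1) :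
    HFlat.caseI (hasseD (ZMod p) 3) u p (p ^ 1) (alpha (T p) (uu p)) (beta (T p) (uu p))
        (gamma (T p) (uu p) ⟨0, frontierLength_T_pos p⟩) (eps p) =
      hasseDeriv (e3 (p - 1) 1 0) (eps p) * hasseDeriv (e3 0 p p) (eps p) := by
  obtain rfl : u = 1 := Units.ext (by simpa using hu)
  show (↑(1 : (R p)ˣ)⁻¹ : R p) * hasseDeriv (alpha (T p) (uu p) + p • beta (T p) (uu p)) (eps p) *
      hasseDeriv (p ^ 1 • gamma (T p) (uu p) ⟨0, frontierLength_T_pos p⟩) (eps p) = _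
  rw [inv_one, Units.val_one, one_mul, alpha_T, beta_T, gamma_zero_T, smul_zero, add_zero, pow_one, smul_e3,
    mul_zero, mul_one]

/-- **`H♭(ε) = ε + ω₂^{p²+2p}` for the witness datum.** [folklore] -/
theorem caseI_eq_eps_add (u : (R p)ˣ) (hu : (u : R p) = 1) :
    HFlat.caseI (hasseD (ZMod p) 3) u p (p ^ 1) (alpha (T p) (uu p)) (beta (T p) (uu p))
        (gamma (T p) (uu p) ⟨0, frontierLength_T_pos p⟩) (eps p) =
      eps p + (X 2 : R p) ^ (p ^ 2 + 2 * p) := by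
  rw [caseI_eq p u hu, hd_prod, X2_pow_eq]

/-- AT `ξ` the bound holds with equality: `ord H♭(ε) = 3p = ord ε`. [folklore] -/
theorem adicOrder_caseI (u : (R p)ˣ) (hu : (u : R p) = 1) :
    adicOrder (HFlat.caseI (hasseD (ZMod p) 3) u p (p ^ 1) (alpha (T p) (uu p)) (beta (T p) (uu p))
        (gamma (T p) (uu p) ⟨0, frontierLength_T_pos p⟩) (eps p)) = ((3 * p : ℕ) : ℕ∞) := by
  rw [caseI_eq p u hu, adicOrder_eq_order, order_hd_prod]

end AlongCentreWitness

end CampaignW21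

end Summit.ResolutionOfSingularities.ResolutionOfSingularities.Theorems

end
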